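import Literature.NumberTheory.ComplexMultiplication.CMTypeRankAlternatingBlock
import Literature.NumberTheory.ComplexMultiplication.QuarticCMTypes
import HarnessLib

/-!
# CM fields `K ⊇ k` (imaginary quadratic) with `Gal(K₀ᶜ/ℚ) ⊇ Aₙ`: every primitive CM type is nondegenerate
# for `n` odd (Dodson 1987, Prop. 2.1); for `n` even exactly the types balanced over `k` are degenerate, of rank `n`

B. Dodson, *On the Mumford–Tate group of an abelian variety with complex multiplication*, J. Algebra **111**
(1987) [Dodson1987] (held text `paper:doi-10-1016-0021-8693-87-90242-0`, pp. 58–59), **Proposition 2.1**: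
"Let `n` be odd and suppose that `K` is a CM-field of degree `2n` such that the maximal totally real subfield `K₀`
has `Gal(K₀ᶜ/ℚ) ≅ Aₙ`, or `Sₙ`.  Then every primitive CM-type `(K, Φ)` is nondegenerate."  Its proof in the case
"`K` contains an imaginary quadratic subfield" (Dodson 1984 [Dodson1984] §3.1.1, the constant weight criterion, "a
case emphasized in this context by Weil" [Weil1977HodgeRing]) is the group-level file `CMTypeRankAlternatingBlock`.

This file is its NUMBER-FIELD dress, in the vocabulary of the tree (`K` a number field with complex CM types
`Φ : CMType K`, `L/ℚ` a Galois CM field receiving `K` by `j : K →ₐ[ℚ] L` — a normal closure `Kᶜ` where the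
hypothesis is on `[Kᶜ : ℚ]` —, Pohlmann's `cmTypeRank Φ` = Dodson's `t(Φ) = Rank(Φ)`, `IsNondegenerate Φ`
(`Rank = n + 1`), Shimura's `IsPrimitive (ℂ ≃+* ℂ) Φ.1 φ₀`; the imaginary quadratic subfield enters as a BLOCK
`Φ₀ : CMType K` — a type whose reflex field is quadratic, e.g. `inducedCMType k (single φ₀)` for `k : k₀ →+* K` —
and the weight of `Φ` over it is `w = |Φ₀ ∖ Φ|`, `n = [K : ℚ]/2`).  The hypothesis "`Gal(K₀ᶜ/ℚ) ≅ Aₙ or Sₙ`" is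
`n! ∣ [Kᶜ : ℚ]` (as `Gal(Kᶜ/k) ≅ Gal(K₀ᶜ/ℚ) ↪ Sₙ` and `[Kᶜ : ℚ] = 2·|Gal(K₀ᶜ/ℚ)|`).  Throughout `n ≥ 3`.

## Results (theorems only; no definition, no named fact)

* `isNondegenerate_of_factorial_dvd` — weight `0 < w < n`, `2w ≠ n` ⟹ `Φ` NONDEGENERATE (`Rank = n + 1`);
* `cmTypeRank_eq_of_factorial_dvd_of_balanced`, `not_isNondegenerate_of_factorial_dvd_of_balanced` — `2w = n` ⟹
  `Rank(Φ) = n` EXACTLY (degenerate of corank one: Weil's types balanced over `k`);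
* `isPrimitive_of_factorial_dvd` — `0 < w < n` ⟹ `Φ` PRIMITIVE (a simple CM abelian `n`-fold);
  `not_subset_and_inter_nonempty_of_isPrimitive` — conversely a primitive type has `0 < w < n` (`n ≥ 2`, no
  hypothesis on the group);
* **`isNondegenerate_iff_of_isPrimitive_of_factorial_dvd`** — for a PRIMITIVE `Φ`: nondegenerate ⟺ `2w ≠ n`;
* **`isNondegenerate_of_isPrimitive_of_factorial_dvd_of_odd`** — **Prop. 2.1: `n` odd ⟹ every primitive type of
  `K` is nondegenerate**; and the same over an explicit imaginary quadratic `k : k₀ →+* K`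
  (`isNondegenerate_of_isPrimitive_of_ringHom_of_odd`, `isNondegenerate_iff_of_isPrimitive_of_ringHom`);
* `finrank_reflexField_eq_two_mul_choose_of_factorial_dvd`, `finrank_reflexField_eq_choose_of_factorial_dvd` — the
  reflex degrees `[K′(Φ) : ℚ] = C(n,w) + C(n,n−w)` (`2w ≠ n`) and `C(n, n/2)` (`2w = n`): the partition
  `2ⁿ = 2 + Σ_{0<w<n/2} 2C(n,w) (+ C(n,n/2))` of the types of `K` by reflex degree for "`⟨ρ⟩ × Sₙ`" [Dodson1984] §4.0.

## References

* [Dodson1987] B. Dodson, J. Algebra 111 (1987), Prop. 2.1 (pp. 58–59).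
* [Dodson1984] B. Dodson, Trans. AMS 283 (1984), §3.1.0–3.1.1 (pp. 11–12), §1.3 Remark, §4.0.
* [Weil1977HodgeRing] A. Weil, *Abelian varieties and the Hodge ring* (1977) — Dodson 1984's reference [24].
* [Shimura1998] G. Shimura, *Abelian varieties with complex multiplication and modular functions*, §8.2 Prop. 26.
-/

set_option autoImplicit false

open scoped Pointwise

namespace Literature.NumberTheory.ComplexMultiplication

section NumberField

open NumberField
open Literature.AlgebraicGeometry.Motives (CMType)
open Literature.AlgebraicGeometry.Pohlmann1968 (cmTypeRank IsNondegenerate)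

variable {K : Type} [Field K] [NumberField K]
variable {L : Type} [Field L] [NumberField L] [IsCMField L] [IsGalois ℚ L]

omit [IsCMField L] [IsGalois ℚ L] in
/-- `algValuedIn` commutes with `∩`. [folklore] -/
private theorem algValuedIn_inter (ι : L →+* ℂ) (Ψ Ψ' : Set (K →+* ℂ)) :
    algValuedIn ι (Ψ ∩ Ψ') = algValuedIn ι Ψ ∩ algValuedIn ι Ψ' := rfl

omit [IsCMField L] [IsGalois ℚ L] in
/-- `algValuedIn` commutes with `∖`. [folklore] -/
private theorem algValuedIn_sdiff (ι : L →+* ℂ) (Ψ Ψ' : Set (K →+* ℂ)) :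
    algValuedIn ι (Ψ \ Ψ') = algValuedIn ι Ψ \ algValuedIn ι Ψ' := rfl

omit [IsCMField L] [IsGalois ℚ L] in
/-- `algValuedIn` reflects `⊆` (for `L/ℚ` normal, `ψ ↦ ι ∘ ψ` is onto `Hom(K, ℂ)`). [folklore] -/
private theorem algValuedIn_subset_iff [Normal ℚ L] (j : K →ₐ[ℚ] L) (ι : L →+* ℂ) (Ψ Ψ' : Set (K →+* ℂ)) :
    algValuedIn ι Ψ ⊆ algValuedIn ι Ψ' ↔ Ψ ⊆ Ψ' := by
  constructor
  · intro hs τ hτ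
    obtain ⟨χ, rfl⟩ := (algHomEquivRingHomOfNormal j ι).surjective τ
    exact hs hτ
  · intro hs χ hχ
    exact hs hχ

omit [IsCMField L] [IsGalois ℚ L] in
/-- `algValuedIn` reflects non-emptiness. [folklore] -/
private theorem algValuedIn_nonempty_iff [Normal ℚ L] (j : K →ₐ[ℚ] L) (ι : L →+* ℂ) (Ψ : Set (K →+* ℂ)) :
    (algValuedIn ι Ψ).Nonempty ↔ Ψ.Nonempty := by
  rw [← Set.ncard_pos (Set.toFinite _), ← Set.ncard_pos (Set.toFinite _), ncard_algValuedIn j ι]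

omit [IsCMField L] [IsGalois ℚ L] in
/-- `|Hom_ℚ(K, L)| = [K : ℚ]` for `L/ℚ` normal receiving `K`. [folklore] -/
private theorem card_algHom_eq [Normal ℚ L] (j : K →ₐ[ℚ] L) (ι : L →+* ℂ) :
    Fintype.card (K →ₐ[ℚ] L) = Module.finrank ℚ K := by
  rw [Fintype.card_congr (algHomEquivRingHomOfNormal j ι), Embeddings.card]

omit [IsCMField L] [IsGalois ℚ L] in
/-- The block has `n = [K : ℚ]/2` members in `Hom_ℚ(K, L)`. [cite: Dodson1984, §3.1.0] -/
private theorem ncard_algValuedIn_cmType [Normal ℚ L] (j : K →ₐ[ℚ] L) (ι : L →+* ℂ) (Φ₀ : CMType K) :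
    (algValuedIn ι Φ₀.1).ncard = Module.finrank ℚ K / 2 := by
  rw [ncard_algValuedIn j ι, ncard_cmType_eq]

/-! ### The exact rank -/

section NormalClosure

variable [IsNormalClosure ℚ K L]

omit [IsCMField L] [IsNormalClosure ℚ K L] in
/-- `n! ∣ [Kᶜ : ℚ]` read on `G = Gal(Kᶜ/ℚ)`: `n! ∣ |G|` with `n` the size of the block. [cite: Dodson1987, Prop. 2.1] -/
private theorem factorial_dvd_card (j : K →ₐ[ℚ] L) (ι : L →+* ℂ) (Φ₀ : CMType K)
    (hfac : (Module.finrank ℚ K / 2).factorial ∣ Module.finrank ℚ L) :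
    ((algValuedIn ι Φ₀.1).ncard).factorial ∣ Nat.card (L ≃ₐ[ℚ] L) := by
  rwa [ncard_algValuedIn_cmType j ι, IsGalois.card_aut_eq_finrank]

/-- **Unbalanced weight ⟹ NONDEGENERATE.**  For a CM type `Φ` of `K` of weight `w = |Φ₀ ∖ Φ|` over a block `Φ₀`
(a type with quadratic reflex field), `0 < w < n`, `2w ≠ n`, with `n! ∣ [Kᶜ : ℚ]`, `n ≥ 3`: `Rank(Φ) = n + 1`.
[cite: Dodson1987, Prop. 2.1 (proof)] [cite: Dodson1984, §3.1.1 Theorem] -/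
theorem isNondegenerate_of_factorial_dvd (j : K →ₐ[ℚ] L) (ι : L →+* ℂ) (Φ₀ Φ : CMType K)
    (h2 : Module.finrank ℚ (reflexField ℚ L (algValuedIn ι Φ₀.1)) = 2)
    (hfac : (Module.finrank ℚ K / 2).factorial ∣ Module.finrank ℚ L) (h3 : 6 ≤ Module.finrank ℚ K)
    (hw0 : ¬ Φ₀.1 ⊆ Φ.1) (hwn : (Φ.1 ∩ Φ₀.1).Nonempty) (hw : 2 * (Φ₀.1 \ Φ.1).ncard ≠ Module.finrank ℚ K / 2) :
    IsNondegenerate Φ := by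
  haveI : Nonempty (K →ₐ[ℚ] L) := ⟨j⟩
  have h₀ := isCMTypeWith_conjGal_algValuedIn ι Φ₀
  have h := isCMTypeWith_conjGal_algValuedIn ι Φ
  have hG := smul_algValuedIn_eq_or_of_finrank_reflexField_eq_two j ι Φ₀ h2
  have hn := ncard_algValuedIn_cmType j ι Φ₀
  rw [isNondegenerate_iff_typeRank_algValuedIn j ι Φ]
  refine h.typeRank_eq_of_factorial_dvd h₀ hG (factorial_dvd_card j ι Φ₀ hfac) (by rw [hn]; omega)
    (by rwa [algValuedIn_subset_iff j ι]) (by rwa [← algValuedIn_inter, algValuedIn_nonempty_iff j ι]) ?_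
  rwa [← algValuedIn_sdiff, ncard_algValuedIn j ι, hn]

/-- **Balanced weight ⟹ rank EXACTLY `n`** (`2w = n`; degenerate of corank one — Dodson's "`t(Φ) = r` may also
occur", Weil's types balanced over the imaginary quadratic subfield). [cite: Dodson1987, Prop. 2.1 (proof)]
[cite: Dodson1984, §3.1.1 Theorem] -/
theorem cmTypeRank_eq_of_factorial_dvd_of_balanced (j : K →ₐ[ℚ] L) (ι : L →+* ℂ) (Φ₀ Φ : CMType K)
    (h2 : Module.finrank ℚ (reflexField ℚ L (algValuedIn ι Φ₀.1)) = 2)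
    (hfac : (Module.finrank ℚ K / 2).factorial ∣ Module.finrank ℚ L) (h3 : 6 ≤ Module.finrank ℚ K)
    (hw : 2 * (Φ₀.1 \ Φ.1).ncard = Module.finrank ℚ K / 2) : cmTypeRank Φ = Module.finrank ℚ K / 2 := by
  haveI : Nonempty (K →ₐ[ℚ] L) := ⟨j⟩
  have h₀ := isCMTypeWith_conjGal_algValuedIn ι Φ₀
  have h := isCMTypeWith_conjGal_algValuedIn ι Φ
  have hG := smul_algValuedIn_eq_or_of_finrank_reflexField_eq_two j ι Φ₀ h2
  have hn := ncard_algValuedIn_cmType j ι Φ₀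
  have key := h.typeRank_eq_of_factorial_dvd_of_balanced h₀ hG (factorial_dvd_card j ι Φ₀ hfac) (by rw [hn]; omega)
    (by rw [← algValuedIn_sdiff, ncard_algValuedIn j ι, hn, hw])
  rwa [typeRank_algValuedIn_eq_cmTypeRank j ι Φ, card_algHom_eq j ι] at key

/-- … hence DEGENERATE. [cite: Dodson1984, §3.1.1 Theorem] -/
theorem not_isNondegenerate_of_factorial_dvd_of_balanced (j : K →ₐ[ℚ] L) (ι : L →+* ℂ) (Φ₀ Φ : CMType K)
    (h2 : Module.finrank ℚ (reflexField ℚ L (algValuedIn ι Φ₀.1)) = 2)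
    (hfac : (Module.finrank ℚ K / 2).factorial ∣ Module.finrank ℚ L) (h3 : 6 ≤ Module.finrank ℚ K)
    (hw : 2 * (Φ₀.1 \ Φ.1).ncard = Module.finrank ℚ K / 2) : ¬ IsNondegenerate Φ := by
  rw [Literature.AlgebraicGeometry.Pohlmann1968.isNondegenerate_iff,
    cmTypeRank_eq_of_factorial_dvd_of_balanced j ι Φ₀ Φ h2 hfac h3 hw]
  omega

/-- **Weight `0 < w < n` ⟹ PRIMITIVE** (the abelian varieties of type `(K, Φ)` are simple `n`-folds).
[cite: Dodson1987, Prop. 2.1 (proof)] [cite: Shimura1998, §8.2 Prop. 26] -/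
theorem isPrimitive_of_factorial_dvd (j : K →ₐ[ℚ] L) (ι : L →+* ℂ) (Φ₀ Φ : CMType K)
    (h2 : Module.finrank ℚ (reflexField ℚ L (algValuedIn ι Φ₀.1)) = 2)
    (hfac : (Module.finrank ℚ K / 2).factorial ∣ Module.finrank ℚ L) (h3 : 6 ≤ Module.finrank ℚ K)
    (hw0 : ¬ Φ₀.1 ⊆ Φ.1) (hwn : (Φ.1 ∩ Φ₀.1).Nonempty) (φ₀ : K →+* ℂ) : IsPrimitive (ℂ ≃+* ℂ) Φ.1 φ₀ := by
  haveI : Nonempty (K →ₐ[ℚ] L) := ⟨j⟩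
  have h₀ := isCMTypeWith_conjGal_algValuedIn ι Φ₀
  have h := isCMTypeWith_conjGal_algValuedIn ι Φ
  have hG := smul_algValuedIn_eq_or_of_finrank_reflexField_eq_two j ι Φ₀ h2
  have hn := ncard_algValuedIn_cmType j ι Φ₀
  exact (isPrimitive_algValuedIn_iff j ι Φ.1 j φ₀).1 (h.isPrimitive_of_factorial_dvd h₀ hG
    (factorial_dvd_card j ι Φ₀ hfac) (by rw [hn]; omega) (by rwa [algValuedIn_subset_iff j ι])
    (by rwa [← algValuedIn_inter, algValuedIn_nonempty_iff j ι]) j)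

end NormalClosure

/-- **A primitive type is neither the block nor its conjugate**: `0 < |Φ₀ ∖ Φ|` and `Φ ∩ Φ₀ ≠ ∅` (`n ≥ 2`; no
hypothesis on the Galois group). [cite: Dodson1984, §3.1.1 Theorem (proof)] [cite: Shimura1998, §8.2 Prop. 26] -/
theorem not_subset_and_inter_nonempty_of_isPrimitive (j : K →ₐ[ℚ] L) (ι : L →+* ℂ) (Φ₀ Φ : CMType K)
    (h2 : Module.finrank ℚ (reflexField ℚ L (algValuedIn ι Φ₀.1)) = 2) (h4 : 4 ≤ Module.finrank ℚ K)
    {φ₀ : K →+* ℂ} (hP : IsPrimitive (ℂ ≃+* ℂ) Φ.1 φ₀) : ¬ Φ₀.1 ⊆ Φ.1 ∧ (Φ.1 ∩ Φ₀.1).Nonempty := by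
  haveI : Nonempty (K →ₐ[ℚ] L) := ⟨j⟩
  have h₀ := isCMTypeWith_conjGal_algValuedIn ι Φ₀
  have h := isCMTypeWith_conjGal_algValuedIn ι Φ
  have hG := smul_algValuedIn_eq_or_of_finrank_reflexField_eq_two j ι Φ₀ h2
  have hn := ncard_algValuedIn_cmType j ι Φ₀
  have key := h.not_subset_and_inter_nonempty_of_isPrimitive h₀ hG (by rw [hn]; omega)
    ((isPrimitive_algValuedIn_iff j ι Φ.1 j φ₀).2 hP)
  rwa [algValuedIn_subset_iff j ι, ← algValuedIn_inter, algValuedIn_nonempty_iff j ι] at key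

section NormalClosure

variable [IsNormalClosure ℚ K L]

/-- **For a PRIMITIVE type: nondegenerate ⟺ unbalanced over `k`** (`n! ∣ [Kᶜ : ℚ]`, `n ≥ 3`).
[cite: Dodson1987, Prop. 2.1] [cite: Dodson1984, §3.1.1 Theorem] -/
theorem isNondegenerate_iff_of_isPrimitive_of_factorial_dvd (j : K →ₐ[ℚ] L) (ι : L →+* ℂ) (Φ₀ Φ : CMType K)
    (h2 : Module.finrank ℚ (reflexField ℚ L (algValuedIn ι Φ₀.1)) = 2)
    (hfac : (Module.finrank ℚ K / 2).factorial ∣ Module.finrank ℚ L) (h3 : 6 ≤ Module.finrank ℚ K)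
    {φ₀ : K →+* ℂ} (hP : IsPrimitive (ℂ ≃+* ℂ) Φ.1 φ₀) :
    IsNondegenerate Φ ↔ 2 * (Φ₀.1 \ Φ.1).ncard ≠ Module.finrank ℚ K / 2 := by
  obtain ⟨hw0, hwn⟩ := not_subset_and_inter_nonempty_of_isPrimitive j ι Φ₀ Φ h2 (by omega) hP
  exact ⟨fun hN hw => not_isNondegenerate_of_factorial_dvd_of_balanced j ι Φ₀ Φ h2 hfac h3 hw hN,
    fun hw => isNondegenerate_of_factorial_dvd j ι Φ₀ Φ h2 hfac h3 hw0 hwn hw⟩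

/-- **Dodson 1987, Proposition 2.1** (the case `K ⊇ k` imaginary quadratic): for `n = [K : ℚ]/2` ODD and
`n! ∣ [Kᶜ : ℚ]` ("`Gal(K₀ᶜ/ℚ) ≅ Aₙ, or Sₙ`"), EVERY primitive CM type of `K` is nondegenerate.
[cite: Dodson1987, Prop. 2.1] -/
theorem isNondegenerate_of_isPrimitive_of_factorial_dvd_of_odd (j : K →ₐ[ℚ] L) (ι : L →+* ℂ) (Φ₀ Φ : CMType K)
    (h2 : Module.finrank ℚ (reflexField ℚ L (algValuedIn ι Φ₀.1)) = 2)
    (hfac : (Module.finrank ℚ K / 2).factorial ∣ Module.finrank ℚ L) (h3 : 6 ≤ Module.finrank ℚ K)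
    (hodd : Odd (Module.finrank ℚ K / 2)) {φ₀ : K →+* ℂ} (hP : IsPrimitive (ℂ ≃+* ℂ) Φ.1 φ₀) :
    IsNondegenerate Φ :=
  (isNondegenerate_iff_of_isPrimitive_of_factorial_dvd j ι Φ₀ Φ h2 hfac h3 hP).2 fun hw => by
    obtain ⟨m, hm⟩ := hodd; omega

/-! ### The reflex degrees: `2·C(n,w)` and `C(n, n/2)` -/

/-- **`[K′(Φ) : ℚ] = C(n,a) + C(n,b)`** (`(a, b) = (|Φ ∩ Φ₀|, |Φ₀ ∖ Φ|)`, `a ≠ b`), `n! ∣ [Kᶜ : ℚ]`, `n ≥ 3`.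
[cite: Dodson1984, §1.3 Remark; §3.1.1 Theorem (proof); §4.0] -/
theorem finrank_reflexField_eq_choose_add_choose_of_factorial_dvd (j : K →ₐ[ℚ] L) (ι : L →+* ℂ)
    (Φ₀ Φ : CMType K) (h2 : Module.finrank ℚ (reflexField ℚ L (algValuedIn ι Φ₀.1)) = 2)
    (hfac : (Module.finrank ℚ K / 2).factorial ∣ Module.finrank ℚ L) (h3 : 6 ≤ Module.finrank ℚ K)
    (hab : (Φ.1 ∩ Φ₀.1).ncard ≠ (Φ₀.1 \ Φ.1).ncard) :
    Module.finrank ℚ (reflexField ℚ L (algValuedIn ι Φ.1)) =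
      (Module.finrank ℚ K / 2).choose (Φ.1 ∩ Φ₀.1).ncard + (Module.finrank ℚ K / 2).choose (Φ₀.1 \ Φ.1).ncard := by
  haveI : Nonempty (K →ₐ[ℚ] L) := ⟨j⟩
  have h₀ := isCMTypeWith_conjGal_algValuedIn ι Φ₀
  have h := isCMTypeWith_conjGal_algValuedIn ι Φ
  have hG := smul_algValuedIn_eq_or_of_finrank_reflexField_eq_two j ι Φ₀ h2
  have hn := ncard_algValuedIn_cmType j ι Φ₀
  have key := h.card_orbit_eq_choose_add_choose_of_factorial_dvd h₀ hG (factorial_dvd_card j ι Φ₀ hfac)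
    (by rw [hn]; omega) (by rwa [← algValuedIn_inter, ← algValuedIn_sdiff, ncard_algValuedIn j ι (Φ.1 ∩ Φ₀.1),
      ncard_algValuedIn j ι (Φ₀.1 \ Φ.1)])
  rw [hn, ← algValuedIn_inter, ← algValuedIn_sdiff, ncard_algValuedIn j ι (Φ.1 ∩ Φ₀.1),
    ncard_algValuedIn j ι (Φ₀.1 \ Φ.1)] at key
  rwa [finrank_reflexField_eq_card_orbit]

/-- **`[K′(Φ) : ℚ] = C(n, n/2)` for a type balanced over `k`** (`|Φ ∩ Φ₀| = |Φ₀ ∖ Φ|`).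
[cite: Dodson1984, §1.3 Remark; §3.1.1 Theorem (proof); §4.0] -/
theorem finrank_reflexField_eq_choose_of_factorial_dvd (j : K →ₐ[ℚ] L) (ι : L →+* ℂ) (Φ₀ Φ : CMType K)
    (h2 : Module.finrank ℚ (reflexField ℚ L (algValuedIn ι Φ₀.1)) = 2)
    (hfac : (Module.finrank ℚ K / 2).factorial ∣ Module.finrank ℚ L) (h3 : 6 ≤ Module.finrank ℚ K)
    (hab : (Φ.1 ∩ Φ₀.1).ncard = (Φ₀.1 \ Φ.1).ncard) :
    Module.finrank ℚ (reflexField ℚ L (algValuedIn ι Φ.1)) = (Module.finrank ℚ K / 2).choose (Φ.1 ∩ Φ₀.1).ncard := by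
  haveI : Nonempty (K →ₐ[ℚ] L) := ⟨j⟩
  have h₀ := isCMTypeWith_conjGal_algValuedIn ι Φ₀
  have h := isCMTypeWith_conjGal_algValuedIn ι Φ
  have hG := smul_algValuedIn_eq_or_of_finrank_reflexField_eq_two j ι Φ₀ h2
  have hn := ncard_algValuedIn_cmType j ι Φ₀
  have key := h.card_orbit_eq_choose_of_factorial_dvd h₀ hG (factorial_dvd_card j ι Φ₀ hfac)
    (by rw [hn]; omega) (by rw [← algValuedIn_inter, ← algValuedIn_sdiff, ncard_algValuedIn j ι (Φ.1 ∩ Φ₀.1),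
      ncard_algValuedIn j ι (Φ₀.1 \ Φ.1), hab])
  rw [hn, ← algValuedIn_inter, ncard_algValuedIn j ι (Φ.1 ∩ Φ₀.1)] at key
  rwa [finrank_reflexField_eq_card_orbit]

end NormalClosure

/-! ### Over an explicit imaginary quadratic subfield `k : k₀ →+* K` -/

section ImaginaryQuadratic

variable {k₀ : Type} [Field k₀] [NumberField k₀] [IsTotallyComplex k₀]
variable [IsNormalClosure ℚ K L]

omit [NumberField K] in
/-- The weight over `ψ₀`: `Φ₀ ∖ Φ = {φ ∉ Φ | φ ∘ k = ψ₀}` for the block `Φ₀` induced from `(k₀, {ψ₀})`.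
[cite: Dodson1984, §3.1.1 Theorem] -/
private theorem inter_inducedCMType_single (h2 : Module.finrank ℚ k₀ = 2) (k : k₀ →+* K) (ψ₀ : k₀ →+* ℂ)
    (Φ : CMType K) :
    (inducedCMType k (CMTypeCount.single h2 ψ₀)).1 \ Φ.1 = {φ : K →+* ℂ | φ ∉ Φ.1 ∧ φ.comp k = ψ₀} := by
  ext φ
  simp only [Set.mem_sdiff, mem_inducedCMType_iff, CMTypeCount.single_val, Set.mem_singleton_iff, Set.mem_setOf_eq]
  tauto

/-- **For a PRIMITIVE type of `K ⊇ k` (imaginary quadratic): nondegenerate ⟺ not balanced over `k`**, i.e.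
`2·|{φ ∉ Φ | φ|ₖ = ψ₀}| ≠ n` (`n! ∣ [Kᶜ : ℚ]`, `n ≥ 3`). [cite: Dodson1987, Prop. 2.1] [cite: Dodson1984, §3.1.1 Theorem] -/
theorem isNondegenerate_iff_of_isPrimitive_of_ringHom (h2 : Module.finrank ℚ k₀ = 2) (k : k₀ →+* K)
    (j : K →ₐ[ℚ] L) (ι : L →+* ℂ) (ψ₀ : k₀ →+* ℂ) (Φ : CMType K)
    (hfac : (Module.finrank ℚ K / 2).factorial ∣ Module.finrank ℚ L) (h3 : 6 ≤ Module.finrank ℚ K)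
    {φ₀ : K →+* ℂ} (hP : IsPrimitive (ℂ ≃+* ℂ) Φ.1 φ₀) :
    IsNondegenerate Φ ↔ 2 * {φ : K →+* ℂ | φ ∉ Φ.1 ∧ φ.comp k = ψ₀}.ncard ≠ Module.finrank ℚ K / 2 := by
  rw [← inter_inducedCMType_single h2 k ψ₀ Φ]
  exact isNondegenerate_iff_of_isPrimitive_of_factorial_dvd j ι _ Φ
    (finrank_reflexField_algValuedIn_inducedCMType_single h2 k j ι ψ₀) hfac h3 hP

/-- **Dodson 1987, Proposition 2.1 for a CM field containing an imaginary quadratic field `k₀`**: `n` odd and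
`n! ∣ [Kᶜ : ℚ]` ⟹ every primitive CM type is nondegenerate. [cite: Dodson1987, Prop. 2.1] -/
theorem isNondegenerate_of_isPrimitive_of_ringHom_of_odd (h2 : Module.finrank ℚ k₀ = 2) (k : k₀ →+* K)
    (j : K →ₐ[ℚ] L) (ι : L →+* ℂ) (Φ : CMType K)
    (hfac : (Module.finrank ℚ K / 2).factorial ∣ Module.finrank ℚ L) (h3 : 6 ≤ Module.finrank ℚ K)
    (hodd : Odd (Module.finrank ℚ K / 2)) {φ₀ : K →+* ℂ} (hP : IsPrimitive (ℂ ≃+* ℂ) Φ.1 φ₀) :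
    IsNondegenerate Φ :=
  isNondegenerate_of_isPrimitive_of_factorial_dvd_of_odd j ι _ Φ
    (finrank_reflexField_algValuedIn_inducedCMType_single h2 k j ι (φ₀.comp k)) hfac h3 hodd hP

end ImaginaryQuadratic

end NumberField

end Literature.NumberTheory.ComplexMultiplication
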